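import Summits.ValiantsHypothesis.ValiantsHypothesis.Theorems.LangWeilTransferTameResolutionPderivSizes
import Summits.ValiantsHypothesis.ValiantsHypothesis.Theorems.LangWeilTransferTameResolutionSpecializeSizes
import Summits.ValiantsHypothesis.ValiantsHypothesis.Theorems.LangWeilTransferTameResolutionFlatSizes

/-!
# LangWeilTransfer, support item `TameResolution` (stmt-ValiantsHypothesis-6378) — the total
# flattening `ℤ[T][Λ][U] ≅ ℤ[X_0..X_{n+r}]` and how `Λ ↦ c` and `∂_{Λ_j}` look through it

Route `LangWeilTransfer` of `ValiantsHypothesis` (conditional route; honest framing: bookkeeping,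
nothing here bears on VP ≠ VNP). Quantitative pass, third link of the size chain (roadmap note of
val-lit-p6 g9, §4 (S)): the numerators `V_j = -(∂_{Λ_j} q · B)(Λ := c)` and the fibre `q_c` are
products and specialisations in `ℤ[T][Λ][U]`; after the total flattening
`Flat P = (finSuccEquiv ℤ (n+r))⁻¹ (P.map flat₁)` (`U ↦ X_0`, `Λ_j ↦ X_{succ (e (inl j))}`,
`T_k ↦ X_{succ (e (inr k))}`, `e = finSumFinEquiv`) they become plain products, an `aeval` by
variables and constants `c_j` (`Flat_map_specC`) and a partial derivative (`Flat_dq`) — so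
`weight_aeval_le_mul_pow`, `weight_mul_le`, `weight_pderiv_le` and the degree analogues apply.

* `flat₁_specC` — `rename succ (sp_c b) = aeval g' (flat₁ b)` for `b ∈ ℤ[T][Λ]`;
* `Flat_map_specC` — `(finSuccEquiv ℤ r)⁻¹ (P.map sp_c) = aeval g (Flat P)`;
* `flat₁_pderiv`, `Flat_dq` — `Flat (∂_{Λ_j} q) = pderiv (succ (e (inl j))) (Flat q)`.
-/

noncomputable section

open MvPolynomial

-- the summit and the problem share the name `ValiantsHypothesis` (D-0017 single-conjunct layout)
set_option linter.dupNamespace false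

namespace Summit.ValiantsHypothesis.ValiantsHypothesis.Theorems.LangWeilTransfer

variable {r n : ℕ}

/-- `Λ ↦ c` on one coefficient, through the flattening: `rename succ (sp_c b) = aeval g' (flat₁ b)`
with `g'` sending the `Λ_j`-variable to `c_j` and the `T_k`-variable to `X_{k+1}`. -/
theorem flat₁_specC (c : Fin n → ℕ) (b : MvPolynomial (Fin n) (MvPolynomial (Fin r) ℤ)) :
    let sp : MvPolynomial (Fin n) (MvPolynomial (Fin r) ℤ) →+* MvPolynomial (Fin r) ℤ :=
      eval fun j => ((c j : ℕ) : MvPolynomial (Fin r) ℤ)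
    let g' : Fin (n + r) → MvPolynomial (Fin (r + 1)) ℤ :=
      fun v => Sum.elim (fun j => C ((c j : ℕ) : ℤ)) (fun k => X k.succ) (finSumFinEquiv.symm v)
    rename Fin.succ (sp b) = aeval g' (rename finSumFinEquiv ((sumAlgEquiv ℤ (Fin n) (Fin r)).symm b)) := by
  intro sp g'
  set f := (sumAlgEquiv ℤ (Fin n) (Fin r)).symm b with hf
  have hb : b = sumAlgEquiv ℤ (Fin n) (Fin r) f := by rw [hf, AlgEquiv.apply_symm_apply]
  have h1 := congrArg (fun φ => φ f) (specC_comp_unflat (r := r) c)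
  simp only [RingHom.comp_apply, RingEquiv.toRingHom_eq_coe, AlgEquiv.toRingEquiv_toRingHom, RingHom.coe_coe,
    AlgHom.toRingHom_eq_coe] at h1
  change sp (sumAlgEquiv ℤ (Fin n) (Fin r) f) = aeval _ f at h1
  rw [hb, h1, aeval_rename]
  have h2 := congrArg (fun φ => φ f)
    (MvPolynomial.comp_aeval (R := ℤ)
      (f := (Sum.elim (fun j => C ((c j : ℕ) : ℤ)) (fun k => X k) : Fin n ⊕ Fin r → MvPolynomial (Fin r) ℤ))
      (rename Fin.succ : MvPolynomial (Fin r) ℤ →ₐ[ℤ] MvPolynomial (Fin (r + 1)) ℤ))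
  simp only [AlgHom.comp_apply] at h2
  rw [h2]
  have hfun : (fun i => rename Fin.succ ((Sum.elim (fun j => C ((c j : ℕ) : ℤ)) (fun k => X k) :
      Fin n ⊕ Fin r → MvPolynomial (Fin r) ℤ) i)) = g' ∘ finSumFinEquiv := by
    funext v
    rcases v with j | k
    · simp only [Sum.elim_inl, rename_C, Function.comp_apply, g', Equiv.symm_apply_apply]
    · simp only [Sum.elim_inr, rename_X, Function.comp_apply, g', Equiv.symm_apply_apply]
  rw [hfun]

/-- **`Λ ↦ c` through the total flattening.** -/
theorem Flat_map_specC (c : Fin n → ℕ) (P : Polynomial (MvPolynomial (Fin n) (MvPolynomial (Fin r) ℤ))) :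
    let flat₁ : MvPolynomial (Fin n) (MvPolynomial (Fin r) ℤ) →+* MvPolynomial (Fin (n + r)) ℤ :=
      (rename finSumFinEquiv : MvPolynomial (Fin n ⊕ Fin r) ℤ →ₐ[ℤ] MvPolynomial (Fin (n + r)) ℤ).toRingHom.comp
        (sumAlgEquiv ℤ (Fin n) (Fin r)).symm.toRingEquiv.toRingHom
    let sp : MvPolynomial (Fin n) (MvPolynomial (Fin r) ℤ) →+* MvPolynomial (Fin r) ℤ :=
      eval fun j => ((c j : ℕ) : MvPolynomial (Fin r) ℤ)
    let g : Fin (n + r + 1) → MvPolynomial (Fin (r + 1)) ℤ :=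
      Fin.cases (X 0) (fun v => Sum.elim (fun j => C ((c j : ℕ) : ℤ)) (fun k => X k.succ) (finSumFinEquiv.symm v))
    (finSuccEquiv ℤ r).symm (P.map sp) = aeval g ((finSuccEquiv ℤ (n + r)).symm (P.map flat₁)) := by
  intro flat₁ sp g
  rw [finSuccEquiv_symm_eq_sum, finSuccEquiv_symm_eq_sum, map_sum]
  -- supports: that of `P.map sp` is inside that of `P`; sum over `P.support` on both sides
  have hflat_inj : Function.Injective flat₁ :=
    (rename_injective _ (Equiv.injective _)).comp (sumAlgEquiv ℤ (Fin n) (Fin r)).symm.injective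
  rw [Polynomial.support_map_of_injective P hflat_inj]
  rw [Finset.sum_subset (Polynomial.support_map_subset sp P) (fun i _ hi => by
    rw [Polynomial.notMem_support_iff.1 hi, map_zero, zero_mul])]
  refine Finset.sum_congr rfl fun i _ => ?_
  rw [Polynomial.coeff_map, Polynomial.coeff_map, map_mul, map_pow, aeval_X, aeval_rename]
  have hg0 : g 0 = X 0 := rfl
  have hgs : (g ∘ Fin.succ) = fun v => Sum.elim (fun j => C ((c j : ℕ) : ℤ)) (fun k => X k.succ) (finSumFinEquiv.symm v) := by
    funext v; rfl
  rw [hg0, hgs]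
  congr 1
  exact flat₁_specC c (P.coeff i)

/-- `∂_{Λ_j}` on one coefficient, through the flattening:
`flat₁ (∂_j b) = ∂_{e (inl j)} (flat₁ b)`. -/
theorem flat₁_pderiv (j : Fin n) (b : MvPolynomial (Fin n) (MvPolynomial (Fin r) ℤ)) :
    rename finSumFinEquiv ((sumAlgEquiv ℤ (Fin n) (Fin r)).symm (pderiv j b)) =
      pderiv (finSumFinEquiv (Sum.inl j)) (rename finSumFinEquiv ((sumAlgEquiv ℤ (Fin n) (Fin r)).symm b)) := by
  rw [sumAlgEquiv_symm_pderiv, pderiv_rename (Equiv.injective _)]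

/-- **`∂_{Λ_j}` through the total flattening:** `Flat (∂_{Λ_j} q) = ∂_{succ (e (inl j))} (Flat q)`. -/
theorem Flat_dq (j : Fin n) (q : Polynomial (MvPolynomial (Fin n) (MvPolynomial (Fin r) ℤ))) :
    let flat₁ : MvPolynomial (Fin n) (MvPolynomial (Fin r) ℤ) →+* MvPolynomial (Fin (n + r)) ℤ :=
      (rename finSumFinEquiv : MvPolynomial (Fin n ⊕ Fin r) ℤ →ₐ[ℤ] MvPolynomial (Fin (n + r)) ℤ).toRingHom.comp
        (sumAlgEquiv ℤ (Fin n) (Fin r)).symm.toRingEquiv.toRingHom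
    let dq := optionEquivLeft _ (Fin n) (pderiv (some j) ((optionEquivLeft _ (Fin n)).symm q))
    (finSuccEquiv ℤ (n + r)).symm (dq.map flat₁) =
      pderiv (Fin.succ (finSumFinEquiv (Sum.inl j))) ((finSuccEquiv ℤ (n + r)).symm (q.map flat₁)) := by
  intro flat₁ dq
  classical
  have hcoeff : ∀ i, dq.coeff i = pderiv j (q.coeff i) := by
    intro i
    have h := coeff_optionEquivLeft_pderiv_some ((optionEquivLeft _ (Fin n)).symm q) j i
    rw [AlgEquiv.apply_symm_apply] at h
    exact h
  rw [finSuccEquiv_symm_eq_sum, finSuccEquiv_symm_eq_sum, map_sum]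
  -- sum over `q.support` on both sides
  have hsub : (dq.map flat₁).support ⊆ (q.map flat₁).support := by
    intro i hi
    rw [Polynomial.mem_support_iff, Polynomial.coeff_map] at hi ⊢
    intro h0
    apply hi
    have hflat_inj : Function.Injective flat₁ :=
      (rename_injective _ (Equiv.injective _)).comp (sumAlgEquiv ℤ (Fin n) (Fin r)).symm.injective
    have hq0 : q.coeff i = 0 := hflat_inj (by rw [h0, map_zero])
    rw [hcoeff, hq0, map_zero, map_zero]
  rw [Finset.sum_subset hsub (fun i _ hi => by rw [Polynomial.notMem_support_iff.1 hi, map_zero, zero_mul])]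
  refine Finset.sum_congr rfl fun i _ => ?_
  rw [Polynomial.coeff_map, Polynomial.coeff_map, hcoeff, Derivation.leibniz, smul_eq_mul, smul_eq_mul,
    pderiv_pow, pderiv_X, Pi.single_eq_of_ne (Fin.succ_ne_zero _).symm, mul_zero, mul_zero, zero_add,
    pderiv_rename (Fin.succ_injective _)]
  change rename Fin.succ (rename finSumFinEquiv ((sumAlgEquiv ℤ (Fin n) (Fin r)).symm (pderiv j (q.coeff i)))) * X 0 ^ i = _
  rw [flat₁_pderiv, mul_comm]
  rfl

end Summit.ValiantsHypothesis.ValiantsHypothesis.Theorems.LangWeilTransfer
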